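import Mathlib
import Summits.NavierStokesRegularity.NavierStokesRegularity.Theorems.StretchingWellBindingEnstrophyQuarterLawSparsenessCoarse
import Summits.NavierStokesRegularity.NavierStokesRegularity.Theorems.StretchingWellBindingEnstrophyQuarterLawFarFieldEnstrophy
import Summits.NavierStokesRegularity.NavierStokesRegularity.Theorems.StretchingWellBindingEnstrophyQuarterLawSparsenessTools
import HarnessLib

/-!
# Shelf crux `EnstrophyQuarterLaw` (stmt-NavierStokesRegularity-1574), line «sparse_sieve»:
# FAR FAMILIES ARE BOUNDED AT EVERY SCALE — stub S2 is a NEAR-FIELD statement (unconditional)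

Helper file (`--supports stmt-NavierStokesRegularity-1574 --as helper`) for the OPEN registered stub
`stub_uniformSparseness` (S2). `SparsenessCoarse.sparse_coarse_of_farField` (p816570) bounds the S2 count on a band
of scales `[r_min, r₀]`; its far-field half is in fact SCALE-FREE, and this file isolates it:

* `card_far_le` — for every maximal classical solution on `[0,T)` (`ν, T > 0`), Leray–Hopf from a rapidly
  decaying datum, there is `ρ₁ > 0` such that for every `ε₀ > 0` some `N_f ∈ ℕ` bounds, at EVERY late time
  `t ∈ [T/2, T)` and EVERY scale `r > 0`, the size of any `4r`-separated family of centres `x` with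
  `‖x‖ ≥ ρ₁ + 2r` whose balls `B(x, 2r)` carry `∫ |u(t)|³ ≥ ε₀³` (`N_f = ⌊8 C₃/ε₀³⌋`, `C₃` the far-field `L³`
  bound of `SparsenessCoarse.farField_norm_cube_le`, fed by the landed far-field enstrophy bound
  `SparseSieve.stub_farFieldEnstrophy`, p607039);
* `card_le_card_near_add` — hence for an arbitrary admissible family, `card F ≤ N_f + #{x ∈ F : ‖x‖ < ρ₁ + 2r}`.

READING (census currency). Together with `EnstrophyScaleCount` (count `≤ C₀ (r Z(t))³/ε₀⁶`), `SparsenessMacroscopic`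
(bounded count for `r ≥ r_min`) and `SwarmTimes` (swarm times have measure `O(r)`), the open content of S2 is:
NEAR-FIELD (`‖x‖ < ρ₁ + 2r`), FINE-SCALE (`r < r_min`), HIGH-ENSTROPHY (`r Z(t) ≫ ε₀²`), LATE (`t → T`) swarms,
present on a set of times of measure `O(r)`. HONEST FRAMING: unconditional bookkeeping along a HYPOTHETICAL
blow-up; S2, the crux `EnstrophyQuarterLaw` (1574) and Navier–Stokes regularity stay OPEN; no summit statement
is proved. Proof pattern adapted from `SparsenessCoarse.sparse_coarse_of_farField` (g1 hand).
-/

noncomputable section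

-- the summit and its single sub-problem share the name (CONVENTIONS §1), as in every Theorems file
set_option linter.dupNamespace false

namespace Summit.NavierStokesRegularity.NavierStokesRegularity.Theorems.EnstrophyQuarterLaw.FarFamilies

open MeasureTheory Set Metric
open Literature.Analysis Literature.Analysis.FluidPDE
open scoped ENNReal NNReal

variable {ν T : ℝ} {u : ℝ → EuclideanSpace ℝ (Fin 3) → EuclideanSpace ℝ (Fin 3)}
  {p : ℝ → EuclideanSpace ℝ (Fin 3) → ℝ}

/-- **Far families are bounded at every scale (unconditional).** For a maximal classical solution on
`[0,T)` (`ν, T > 0`), Leray–Hopf from a rapidly decaying datum: `∃ ρ₁ > 0, ∀ ε₀ > 0, ∃ N_f, ∀ t ∈ [T/2,T),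
∀ r > 0`, every `4r`-separated finite family of centres `x` with `ρ₁ + 2r ≤ ‖x‖` and
`∫_{B(x,2r)} |u(t)|³ ≥ ε₀³` has at most `N_f` members (the balls lie outside `B(0,ρ₁)`, overlap `≤ 8`-fold, and
`∫_{‖y‖ ≥ ρ₁} |u(t)|³ ≤ C₃` by the far-field enstrophy bound + energy + exterior Sobolev). [folklore] -/
theorem card_far_le (hν : 0 < ν) (hT : 0 < T) (hmax : IsMaximalSmoothSolution ν 0 u p T)
    (hLH : IsLerayHopfOn T ν 0 (u 0) u) (hdec : HasRapidSpatialDecay (u 0)) :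
    ∃ ρ₁ : ℝ, 0 < ρ₁ ∧ ∀ ε₀ : ℝ, 0 < ε₀ → ∃ Nf : ℕ, ∀ t ∈ Ico (T / 2) T, ∀ r : ℝ, 0 < r →
      ∀ F : Finset (EuclideanSpace ℝ (Fin 3)),
        (∀ x ∈ F, ∀ y ∈ F, x ≠ y → 4 * r ≤ dist x y) →
        (∀ x ∈ F, ENNReal.ofReal (ε₀ ^ 3) ≤ ∫⁻ y in ball x (2 * r), ‖u t y‖ₑ ^ 3) →
        (∀ x ∈ F, ρ₁ + 2 * r ≤ ‖x‖) →
        F.card ≤ Nf := by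
  have hsol : IsClassicalNSSolutionOn (Ico 0 T) ν 0 u p := hmax.1
  obtain ⟨ρ, B, hB, hFF⟩ := SparseSieve.stub_farFieldEnstrophy ν T hν hT u p hmax hLH hdec
  obtain ⟨ρ₁, C₃, hρ₁, hC₃, hfar⟩ := SparsenessCoarse.farField_norm_cube_le hν hsol hLH hB hFF
  refine ⟨ρ₁, hρ₁, fun ε₀ hε₀ => ⟨⌊8 * C₃ / ε₀ ^ 3⌋₊, fun t ht r hr F hsep hconc hfarx => ?_⟩⟩
  have htI : t ∈ Ico 0 T := ⟨by linarith [ht.1, ht.2], ht.2⟩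
  -- the balls lie outside `B(0, ρ₁)`
  set S : Set (EuclideanSpace ℝ (Fin 3)) := (ball (0 : EuclideanSpace ℝ (Fin 3)) ρ₁)ᶜ with hS
  have hSm : MeasurableSet S := measurableSet_ball.compl
  have hballS : ∀ x ∈ F, ball x (2 * r) ⊆ S := by
    intro x hx y hy
    have hx' := hfarx x hx
    rw [hS, mem_compl_iff, mem_ball, dist_zero_right, not_lt]
    rw [mem_ball] at hy
    have h1 : ‖x‖ ≤ ‖y‖ + dist y x := by
      have := norm_le_norm_add_norm_sub' x y
      rw [← dist_eq_norm, dist_comm] at this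
      exact this
    linarith
  set g : EuclideanSpace ℝ (Fin 3) → ℝ≥0∞ := S.indicator fun y => ‖u t y‖ₑ ^ 3 with hg
  have hcont : Continuous (u t) := (hsol.contDiff_velocity htI).continuous
  have hgm : AEMeasurable g volume :=
    ((hcont.measurable.enorm.pow_const _).indicator hSm).aemeasurable
  have hsum := SparsenessTools.sum_setLIntegral_ball_le_of_separated (s := 4 * r) (ρ := 2 * r)
    (by positivity) (by positivity) F hsep hgm
  have e8 : ((2 * r + 4 * r / 2) / (4 * r / 2)) ^ 3 = (8 : ℝ) := by
    field_simp
    ring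
  rw [e8] at hsum
  have hgint : ∫⁻ y, g y ≤ ENNReal.ofReal C₃ := by
    rw [hg, lintegral_indicator hSm]
    exact hfar t ht
  have hcard : (F.card : ℝ≥0∞) * ENNReal.ofReal (ε₀ ^ 3) ≤ ENNReal.ofReal (8 * C₃) := by
    calc (F.card : ℝ≥0∞) * ENNReal.ofReal (ε₀ ^ 3)
        = ∑ x ∈ F, ENNReal.ofReal (ε₀ ^ 3) := by rw [Finset.sum_const, nsmul_eq_mul]
      _ ≤ ∑ x ∈ F, ∫⁻ y in ball x (2 * r), g y := by
          refine Finset.sum_le_sum fun x hx => (hconc x hx).trans (le_of_eq ?_)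
          rw [hg, ← lintegral_indicator measurableSet_ball, ← lintegral_indicator measurableSet_ball]
          refine lintegral_congr fun y => ?_
          by_cases hy : y ∈ ball x (2 * r)
          · rw [indicator_of_mem hy, indicator_of_mem hy, indicator_of_mem (hballS x hx hy)]
          · rw [indicator_of_notMem hy, indicator_of_notMem hy]
      _ ≤ ENNReal.ofReal 8 * ∫⁻ y, g y := hsum
      _ ≤ ENNReal.ofReal 8 * ENNReal.ofReal C₃ := mul_le_mul' le_rfl hgint
      _ = ENNReal.ofReal (8 * C₃) := by rw [← ENNReal.ofReal_mul (by norm_num)]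
  have hreal : (F.card : ℝ) * ε₀ ^ 3 ≤ 8 * C₃ := by
    have h1 := ENNReal.toReal_mono ENNReal.ofReal_ne_top hcard
    rwa [ENNReal.toReal_mul, ENNReal.toReal_natCast, ENNReal.toReal_ofReal (by positivity),
      ENNReal.toReal_ofReal (by positivity)] at h1
  refine Nat.le_floor ?_
  rw [le_div_iff₀ (by positivity)]
  exact hreal

/-- **S2 is a near-field statement.** With `ρ₁, N_f` as in `card_far_le`: at every late time `t ∈ [T/2,T)` and
every scale `r > 0`, every `4r`-separated family `F` of `ε₀`-concentrating centres satisfies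
`card F ≤ N_f + #{x ∈ F : ‖x‖ < ρ₁ + 2r}` — only the centres within `ρ₁ + 2r` of the origin are uncounted.
[folklore] -/
theorem card_le_card_near_add (hν : 0 < ν) (hT : 0 < T) (hmax : IsMaximalSmoothSolution ν 0 u p T)
    (hLH : IsLerayHopfOn T ν 0 (u 0) u) (hdec : HasRapidSpatialDecay (u 0)) :
    ∃ ρ₁ : ℝ, 0 < ρ₁ ∧ ∀ ε₀ : ℝ, 0 < ε₀ → ∃ Nf : ℕ, ∀ t ∈ Ico (T / 2) T, ∀ r : ℝ, 0 < r →
      ∀ F : Finset (EuclideanSpace ℝ (Fin 3)),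
        (∀ x ∈ F, ∀ y ∈ F, x ≠ y → 4 * r ≤ dist x y) →
        (∀ x ∈ F, ENNReal.ofReal (ε₀ ^ 3) ≤ ∫⁻ y in ball x (2 * r), ‖u t y‖ₑ ^ 3) →
        F.card ≤ Nf + (F.filter (fun x => ‖x‖ < ρ₁ + 2 * r)).card := by
  classical
  obtain ⟨ρ₁, hρ₁, h⟩ := card_far_le hν hT hmax hLH hdec
  refine ⟨ρ₁, hρ₁, fun ε₀ hε₀ => ?_⟩
  obtain ⟨Nf, hNf⟩ := h ε₀ hε₀
  refine ⟨Nf, fun t ht r hr F hsep hconc => ?_⟩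
  set P : EuclideanSpace ℝ (Fin 3) → Prop := fun x => ‖x‖ < ρ₁ + 2 * r with hP
  have hfar : (F.filter (fun x => ¬ P x)).card ≤ Nf :=
    hNf t ht r hr (F.filter (fun x => ¬ P x))
      (fun x hx y hy hxy => hsep x (Finset.mem_filter.1 hx).1 y (Finset.mem_filter.1 hy).1 hxy)
      (fun x hx => hconc x (Finset.mem_filter.1 hx).1)
      (fun x hx => not_lt.1 (Finset.mem_filter.1 hx).2)
  have htot := Finset.card_filter_add_card_filter_not (s := F) P
  change F.card ≤ Nf + (F.filter P).card
  omega

end Summit.NavierStokesRegularity.NavierStokesRegularity.Theorems.EnstrophyQuarterLaw.FarFamilies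

end
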